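import Summits.CriticalPhenomena.PercolationContinuityZ3.Theorems.PercNearOneGluingNoHeavyLowerTailThreePartitionGridTerminal
import Summits.CriticalPhenomena.PercolationContinuityZ3.Theorems.PercNearOneGluingNoHeavyLowerTailThreePartitionCylinderHall
import HarnessLib.Audit

/-!
# `NoHeavyLowerTail` (crux stmt-CriticalPhenomena-4575), master-family hierarchy P3 (gen 36): the TERMINAL reduction for the twisted
# three-partition functional and COMB-C3 as "a cylinder matching for every terminal pair"

Support file (seat `prim-masterthm-p3`; `--supports stmt-CriticalPhenomena-4575`; memo
`run/shared/lean/prim/prim-masterthm/FROM-prim-masterthm-p3-g36-CYLINDER-SLACK.md` §1).  Glue between `…ThreePartitionGridTerminal`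
(`vStar`, `sum_gtKernel_vStar_le` — V-RED) and `…ThreePartitionCylinderHall` (`CylMatchable`, `cylMatchable_iff`, `threePartNT_eq_sum_filter`).

`threePartNT_vStar_le`: `N_τ(𝒰, V⋆(𝒱∩𝒲,𝒲), 𝒲) ≤ N_τ(𝒰,𝒱,𝒲)` for up-sets (a cylinder over an up-set is closed upwards in the grid order, so V-RED applies);
`threePartNT_wStar_le` (W-side); hence **`threePartitionPositivityTwisted_iff_terminal`** (it suffices to prove `N_τ ≥ 0` for terminal pairs
`(V⋆(𝒜,𝒲), 𝒲)`, `𝒜 ⊆ 𝒲` nested up-sets) and **`threePartitionPositivityTwisted_iff_cylMatchable_terminal`** (⟺ every terminal pair admits a cylinder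
matching) — the weakest matching target of the programme, in the normal form in which the seat's token system lives.
HONEST LABEL: bookkeeping; `ThreePartitionPositivityTwisted`, COMB-C3, Sahi's `C₃` OPEN; nothing bears on the (closed) crux. [this work]
-/

noncomputable section

open Finset
open scoped symmDiff Classical

namespace Summit.CriticalPhenomena.PercolationContinuityZ3.Theorems.ThreePartition

variable {ι : Type*} [Fintype ι]

/-- **V-RED for the twisted functional**: `N_τ(𝒰, V⋆(𝒱∩𝒲,𝒲), 𝒲) ≤ N_τ(𝒰,𝒱,𝒲)` for up-sets `𝒰, 𝒱, 𝒲`. [this work] -/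
theorem threePartNT_vStar_le (τ : Set ι) {𝒰 𝒱 𝒲 : Set (Set ι)} (h𝒰 : IsUpperSet 𝒰) (h𝒱 : IsUpperSet 𝒱) (h𝒲 : IsUpperSet 𝒲) :
    threePartNT τ 𝒰 (vStar (𝒱 ∩ 𝒲) 𝒲) 𝒲 ≤ threePartNT τ 𝒰 𝒱 𝒲 := by
  rw [threePartNT_eq_sum_filter, threePartNT_eq_sum_filter]
  refine sum_gtKernel_vStar_le τ h𝒱 h𝒲 fun q q' hq h1 _ => ?_
  rw [mem_cyl] at hq ⊢
  exact h𝒰 h1 hq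

/-- **W-RED for the twisted functional**: `N_τ(𝒰, 𝒱, V⋆(𝒲∩𝒱,𝒱)) ≤ N_τ(𝒰,𝒱,𝒲)` for up-sets `𝒰, 𝒱, 𝒲`. [this work] -/
theorem threePartNT_wStar_le (τ : Set ι) {𝒰 𝒱 𝒲 : Set (Set ι)} (h𝒰 : IsUpperSet 𝒰) (h𝒱 : IsUpperSet 𝒱) (h𝒲 : IsUpperSet 𝒲) :
    threePartNT τ 𝒰 𝒱 (vStar (𝒲 ∩ 𝒱) 𝒱) ≤ threePartNT τ 𝒰 𝒱 𝒲 := by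
  rw [threePartNT_eq_sum_filter, threePartNT_eq_sum_filter]
  refine sum_gtKernel_wStar_le τ h𝒱 h𝒲 fun q q' hq h1 _ => ?_
  rw [mem_cyl] at hq ⊢
  exact h𝒰 h1 hq

/-- **`ThreePartitionPositivityTwisted` reduces to terminal pairs**: it holds iff `N_τ(𝒰, V⋆(𝒜,𝒲), 𝒲) ≥ 0` for all up-sets `𝒰` and all nested up-sets
`𝒜 ⊆ 𝒲`. [this work] -/
theorem threePartitionPositivityTwisted_iff_terminal :
    ThreePartitionPositivityTwisted ↔
      ∀ (ι : Type) [Fintype ι] (τ : Set ι) (𝒰 𝒜 𝒲 : Set (Set ι)),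
        IsUpperSet 𝒰 → IsUpperSet 𝒜 → IsUpperSet 𝒲 → 𝒜 ⊆ 𝒲 → 0 ≤ threePartNT τ 𝒰 (vStar 𝒜 𝒲) 𝒲 := by
  constructor
  · intro h ι _ τ 𝒰 𝒜 𝒲 h𝒰 h𝒜 h𝒲 _
    exact h ι τ 𝒰 (vStar 𝒜 𝒲) 𝒲 h𝒰 (isUpperSet_vStar h𝒜) h𝒲
  · intro h ι _ τ 𝒰 𝒱 𝒲 h𝒰 h𝒱 h𝒲
    exact le_trans (h ι τ 𝒰 (𝒱 ∩ 𝒲) 𝒲 h𝒰 (h𝒱.inter h𝒲) h𝒲 Set.inter_subset_right) (threePartNT_vStar_le τ h𝒰 h𝒱 h𝒲)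

/-- **COMB-C3 ⟺ every TERMINAL pair admits a cylinder matching.** [this work] -/
theorem threePartitionPositivityTwisted_iff_cylMatchable_terminal :
    ThreePartitionPositivityTwisted ↔
      ∀ (ι : Type) [Fintype ι] (τ : Set ι) (𝒜 𝒲 : Set (Set ι)),
        IsUpperSet 𝒜 → IsUpperSet 𝒲 → 𝒜 ⊆ 𝒲 → CylMatchable τ (vStar 𝒜 𝒲) 𝒲 := by
  rw [threePartitionPositivityTwisted_iff_terminal]
  constructor
  · intro h ι _ τ 𝒜 𝒲 h𝒜 h𝒲 hAW
    exact cylMatchable_of_threePartNT_nonneg τ _ _ fun 𝒰 h𝒰 => h ι τ 𝒰 𝒜 𝒲 h𝒰 h𝒜 h𝒲 hAW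
  · intro h ι _ τ 𝒰 𝒜 𝒲 h𝒰 h𝒜 h𝒲 hAW
    exact threePartNT_nonneg_of_cylMatchable (h ι τ 𝒜 𝒲 h𝒜 h𝒲 hAW) h𝒰

/-- Hence a typed (or grid) matching for every terminal pair also gives COMB-C3 along this route. [this work] -/
theorem threePartitionPositivityTwisted_of_gtMatchable_terminal
    (h : ∀ (ι : Type) [Fintype ι] (τ : Set ι) (𝒜 𝒲 : Set (Set ι)),
      IsUpperSet 𝒜 → IsUpperSet 𝒲 → 𝒜 ⊆ 𝒲 → GTMatchable τ (vStar 𝒜 𝒲) 𝒲) :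
    ThreePartitionPositivityTwisted :=
  threePartitionPositivityTwisted_iff_cylMatchable_terminal.2 fun ι _ τ 𝒜 𝒲 h𝒜 h𝒲 hAW =>
    cylMatchable_of_gtMatchable (h ι τ 𝒜 𝒲 h𝒜 h𝒲 hAW)

end Summit.CriticalPhenomena.PercolationContinuityZ3.Theorems.ThreePartition

end
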